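import Summits.QuantumFields.YangMills.Theorems.BalabanUVNodesN19CoreTVInvariant
import Summits.QuantumFields.YangMills.Theorems.BalabanUVNodesN14LawChannel
import Mathlib.Analysis.Calculus.ParametricIntegral

/-!
# BalabanUVNodes ∕ N19 — THE ANNEALED (TILT-PATH) ROAD, I: FEYNMAN–HELLMANN ALONG A GENERAL C¹ PATH OF TILTS, AND THE
# COVARIANCE ∕ L¹-OSCILLATION ARITHMETIC OF ONE CLASS

Cell `pub-ymgap` (HUMAN RULING D-0062, Track A), node N19 = NE7, R134 seat `pub-ymgap-dag-n19-c` (g9, harness re-seat of g8; door d3 of the g9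
census, bus INTENT-17 l.17277; dag-lead DEDUP l.17308 GO; LENS control g8 GO-17 l.17321 with typing notes (a)–(e), folded).  Filed `--kind proof
--supports` K3⁗ `SpineGivenEndpointR13Sep` = stmt-QuantumFields-20292 `--as helper`.  COUNT-NEUTRAL.  THEOREMS ONLY (0 `def`); imports this seat's 16b
`…N19CoreTVInvariant` (p504410), dag-n14-c's file P `…N14LawChannel` (p499366; for `cov[·,·;·]`, `isProbabilityMeasure_tilted_of_abs_le` and
the tree's `Literature/…/QuantumLattice/WilsonFeynmanHellmann` — the STRAIGHT-chord case, CITED, not re-proved) and Mathlib's parametric integrals.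

THE POINT (one level UP-STREAM of 16b).  16b proved: on common class spaces the observable-uniform `Spine.NE7.Core` ⟺ MASS_cl ∧ TV_cl.  The roads that
PRODUCE MASS ∕ TV in the tree are POINTWISE: DENS_cl⁰ (n19-d p504112), SHAPE_cl ∕ NE7-S_cl (p496221) — a log-density sandwich `|Ψ − c| ≤ r` on the class
support.  This module and its sequels (`…N19TiltPathEndpoints`, `…N19TiltPathRoad`) type the ANNEALED road: join run A's class piece `μ` to run B's
`e^{Ψ_1}·μ` by ANY C¹ one-parameter exponential family `u ↦ e^{ψ_u}·μ` (`ψ 0 = 0`, `ψ 1 = Ψ_1`; the straight chord `u·Ψ_1`, LENS control CARD 11's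
countertermed chord `u·D + κ(u)·S`, multi-counterterm paths …); then by Feynman–Hellmann
  `d∕du log ∫e^{ψ_u}dμ = E_{μ̂_u}[ψ′_u]`   (MASS face)   and   `d∕du ∫f dμ̂_u = Cov_{μ̂_u}(f, ψ′_u)`   (LAW face),   `μ̂_u = μ.tilted (ψ u)`,
so MASS_cl needs only the MEAN of the path direction modulo a class-free drift, and TV_cl only its L¹-OSCILLATION (`|Cov(1_S, g)| ≤ ½·osc(g)`) —
FIRST-MOMENT ∕ L¹ data, implied by the pointwise sandwich on the straight chord (`drift_osc_of_pointwise`) and strictly weaker in general.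

WHAT IS PROVED HERE ([folklore] calculus ∕ measure arithmetic).
* §1 FH ON A TILT PATH (`μ` finite; `ψ u` measurable with pointwise `u`-derivative `ψ′ u`, both LOCALLY UNIFORMLY BOUNDED near the point):
  `hasDerivAt_integral_mul_exp_tiltPath` (dominated differentiation, constant majorant) · `integral_tilted_eq_div` · ★ `hasDerivAt_integral_tilted_tiltPath`
  (moment form) · ★ `hasDerivAt_integral_tilted_tiltPath_eq_cov` (covariance form) · ★ `hasDerivAt_log_integral_exp_tiltPath` (MASS face).
* §2 ONE CLASS: `covariance_eq_integral_mul_sub` (`Cov(f,g) = ∫ f·(g − ḡ)`) · `abs_cov_le_mul_integral_abs_sub` (`|Cov(f,g)| ≤ B·osc(g)`) ·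
  ★ `abs_cov_indicator_le_half_osc` (`|Cov(1_S,g)| ≤ ½·osc(g)`) · `abs_cov_indicator_le_half_condOsc` (LENS control GO-17 (d): for a CLASS-LEVEL set `S ∈ m`
  the relevant oscillation is that of the CONDITIONED direction `ν[g|m]` — companion of file P `abs_cov_le_of_condExp`) · `drift_osc_of_pointwise`.
* §3 DICTIONARY to 16b's TV_cl letters: `withDensity_exp_real` · `tilted_real_eq_div` (`(μ.tilted g)(S) = (e^{g}μ)(S) ∕ (e^{g}μ)(univ)`) · `tilted_zero_real_eq_div`.

HONEST FRAMING.  [folklore]; SUPPORT-MATCHED case only (a tilt path forces `μA ~ μB` class by class; the support-tolerant residue is TV_cl's alone —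
16a `tv_not_shape_toy`); produces nothing of Bałaban's (every path datum is a HYPOTHESIS for NODE O ∕ U3's objects); NE7 NOT PRINTED for d = 4 and NOT
proved; N19 NOT discharged (0∕1); K3⁗ NOT claimed; counts UNMOVED (typed 28∕28 · discharged 5∕27 · A 5∕28); one finite four-torus programme at fixed `ε`
— NOT ℝ⁴, NOT OS, NOT a mass gap, NOT Clay.  0 `def`; 0 `sorry`; standard axioms.
-/

set_option autoImplicit false

noncomputable section

open MeasureTheory ProbabilityTheory Set Filter Topology
open scoped ENNReal

namespace Summit.QuantumFields.YangMills.BalabanUVNodes.N19TiltPathCalculus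

/-! ## §1 Feynman–Hellmann along a C¹ path of tilts `u ↦ μ.tilted (ψ u)` -/
section Path

variable {Ω : Type*} [MeasurableSpace Ω] {μ : Measure Ω} [IsFiniteMeasure μ]
  {ψ ψ' : ℝ → Ω → ℝ} {f : Ω → ℝ} {B : ℝ} {u₀ : ℝ}

/-- A bounded measurable function is integrable against a finite measure (the form used throughout). [folklore] -/
theorem integrable_of_abs_le (hfm : Measurable f) (hfb : ∀ x, |f x| ≤ B) : Integrable f μ :=
  (integrable_const B).mono' hfm.aestronglyMeasurable (Eventually.of_forall fun x => by
    rw [Real.norm_eq_abs]; exact hfb x)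

/-- **DIFFERENTIATION UNDER THE INTEGRAL ALONG A TILT PATH.**  `μ` finite; `ψ u` measurable with pointwise `u`-derivative `ψ′ u`
(measurable), both LOCALLY UNIFORMLY BOUNDED near `u₀`; `f` bounded measurable.  Then
`d∕du ∫ f·e^{ψ_u} dμ |_{u₀} = ∫ f·ψ′_{u₀}·e^{ψ_{u₀}} dμ` (dominated differentiation with a constant majorant). [folklore] -/
theorem hasDerivAt_integral_mul_exp_tiltPath (hψm : ∀ u, Measurable (ψ u)) (hψ'm : ∀ u, Measurable (ψ' u))
    (hψd : ∀ u x, HasDerivAt (fun v => ψ v x) (ψ' u x) u)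
    (hbd : ∃ ε > 0, ∃ M : ℝ, ∀ u ∈ Metric.ball u₀ ε, ∀ x, |ψ u x| ≤ M ∧ |ψ' u x| ≤ M)
    (hfm : Measurable f) (hfb : ∀ x, |f x| ≤ B) :
    HasDerivAt (fun u => ∫ x, f x * Real.exp (ψ u x) ∂μ)
      (∫ x, f x * (Real.exp (ψ u₀ x) * ψ' u₀ x) ∂μ) u₀ := by
  obtain ⟨ε, hε, M, hM⟩ := hbd
  have hu₀ : u₀ ∈ Metric.ball u₀ ε := Metric.mem_ball_self hε
  have hmeasF : ∀ u, AEStronglyMeasurable (fun x => f x * Real.exp (ψ u x)) μ := fun u =>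
    (hfm.mul (Real.measurable_exp.comp (hψm u))).aestronglyMeasurable
  refine (hasDerivAt_integral_of_dominated_loc_of_deriv_le (μ := μ) (x₀ := u₀)
    (F := fun u x => f x * Real.exp (ψ u x)) (F' := fun u x => f x * (Real.exp (ψ u x) * ψ' u x))
    (bound := fun _ => |B| * (Real.exp M * M)) (Metric.ball_mem_nhds u₀ hε) ?_ ?_ ?_ ?_ ?_ ?_).2
  · exact Eventually.of_forall hmeasF
  · refine (integrable_const (|B| * Real.exp M)).mono' (hmeasF u₀) (Eventually.of_forall fun x => ?_)
    rw [Real.norm_eq_abs, abs_mul, Real.abs_exp]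
    exact mul_le_mul ((hfb x).trans (le_abs_self B)) (Real.exp_le_exp.2 ((le_abs_self _).trans (hM u₀ hu₀ x).1))
      (Real.exp_pos _).le (abs_nonneg B)
  · exact (hfm.mul ((Real.measurable_exp.comp (hψm u₀)).mul (hψ'm u₀))).aestronglyMeasurable
  · refine Eventually.of_forall fun x u hu => ?_
    rw [Real.norm_eq_abs, abs_mul, abs_mul, Real.abs_exp]
    refine mul_le_mul ((hfb x).trans (le_abs_self B)) ?_ (by positivity) (abs_nonneg B)
    exact mul_le_mul (Real.exp_le_exp.2 ((le_abs_self _).trans (hM u hu x).1)) (hM u hu x).2 (abs_nonneg _)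
      (Real.exp_pos _).le
  · exact integrable_const _
  · exact Eventually.of_forall fun x u _ => ((hψd u x).exp).const_mul (f x)

omit [IsFiniteMeasure μ] in
/-- The tilted integral as a quotient: `∫ f d(μ.tilted (ψ u)) = (∫ f·e^{ψ_u} dμ) ∕ ∫ e^{ψ_u} dμ`. [folklore; Mathlib `integral_tilted`] -/
theorem integral_tilted_eq_div (g : Ω → ℝ) (f : Ω → ℝ) :
    ∫ x, f x ∂(μ.tilted g) = (∫ x, f x * Real.exp (g x) ∂μ) / ∫ x, Real.exp (g x) ∂μ := by
  rw [integral_tilted, ← integral_div]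
  refine integral_congr_ae (Eventually.of_forall fun x => ?_)
  simp only [smul_eq_mul]
  ring

/-- **FEYNMAN–HELLMANN ALONG A TILT PATH (moment form).**  With `μ̂_u = μ.tilted (ψ u)`:
`d∕du ∫ f dμ̂_u |_{u₀} = ∫ f·ψ′_{u₀} dμ̂_{u₀} − (∫ f dμ̂_{u₀})·(∫ ψ′_{u₀} dμ̂_{u₀})` (quotient rule on the previous lemma; the
straight chord `ψ u = u·X` is the tree's `WilsonFeynmanHellmann.hasDerivAt_integral_tilted`). [folklore] -/
theorem hasDerivAt_integral_tilted_tiltPath (hψm : ∀ u, Measurable (ψ u)) (hψ'm : ∀ u, Measurable (ψ' u))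
    (hψd : ∀ u x, HasDerivAt (fun v => ψ v x) (ψ' u x) u)
    (hbd : ∃ ε > 0, ∃ M : ℝ, ∀ u ∈ Metric.ball u₀ ε, ∀ x, |ψ u x| ≤ M ∧ |ψ' u x| ≤ M)
    (hfm : Measurable f) (hfb : ∀ x, |f x| ≤ B) :
    HasDerivAt (fun u => ∫ x, f x ∂(μ.tilted (ψ u)))
      (∫ x, f x * ψ' u₀ x ∂(μ.tilted (ψ u₀)) -
        (∫ x, f x ∂(μ.tilted (ψ u₀))) * ∫ x, ψ' u₀ x ∂(μ.tilted (ψ u₀))) u₀ := by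
  rcases eq_zero_or_neZero μ with rfl | hμ
  · simp only [tilted_zero_measure, integral_zero_measure, mul_zero, sub_zero]
    exact hasDerivAt_const u₀ 0
  obtain ⟨ε, hε, M, hM⟩ := hbd
  have hu₀ : u₀ ∈ Metric.ball u₀ ε := Metric.mem_ball_self hε
  have hbd' : ∃ ε > 0, ∃ M : ℝ, ∀ u ∈ Metric.ball u₀ ε, ∀ x, |ψ u x| ≤ M ∧ |ψ' u x| ≤ M := ⟨ε, hε, M, hM⟩
  -- numerator and denominator
  have hN := hasDerivAt_integral_mul_exp_tiltPath (μ := μ) hψm hψ'm hψd hbd' hfm hfb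
  have hZ := hasDerivAt_integral_mul_exp_tiltPath (μ := μ) (f := fun _ => (1 : ℝ)) (B := 1) hψm hψ'm hψd hbd'
    measurable_const (fun _ => by simp)
  simp only [one_mul] at hZ
  have hexp : Integrable (fun x => Real.exp (ψ u₀ x)) μ :=
    integrable_of_abs_le (Real.measurable_exp.comp (hψm u₀)) fun x => by
      rw [Real.abs_exp]; exact Real.exp_le_exp.2 ((le_abs_self _).trans (hM u₀ hu₀ x).1)
  have hZpos : 0 < ∫ x, Real.exp (ψ u₀ x) ∂μ := integral_exp_pos hexp
  have key := hN.div hZ hZpos.ne'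
  have hfun : (fun u => ∫ x, f x ∂(μ.tilted (ψ u))) =
      fun u => (∫ x, f x * Real.exp (ψ u x) ∂μ) / ∫ x, Real.exp (ψ u x) ∂μ :=
    funext fun u => integral_tilted_eq_div (ψ u) f
  rw [hfun]
  refine key.congr_deriv ?_
  rw [integral_tilted_eq_div, integral_tilted_eq_div, integral_tilted_eq_div]
  have e1 : ∫ x, f x * ψ' u₀ x * Real.exp (ψ u₀ x) ∂μ = ∫ x, f x * (Real.exp (ψ u₀ x) * ψ' u₀ x) ∂μ :=
    integral_congr_ae (Eventually.of_forall fun x => by ring)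
  have e2 : ∫ x, ψ' u₀ x * Real.exp (ψ u₀ x) ∂μ = ∫ x, Real.exp (ψ u₀ x) * ψ' u₀ x ∂μ :=
    integral_congr_ae (Eventually.of_forall fun x => by ring)
  rw [e1, e2]
  set A := ∫ x, f x * (Real.exp (ψ u₀ x) * ψ' u₀ x) ∂μ
  set N := ∫ x, f x * Real.exp (ψ u₀ x) ∂μ
  set D := ∫ x, Real.exp (ψ u₀ x) * ψ' u₀ x ∂μ
  set Z := ∫ x, Real.exp (ψ u₀ x) ∂μ
  have hZne : Z ≠ 0 := hZpos.ne'
  field_simp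

/-- **FEYNMAN–HELLMANN ALONG A TILT PATH (covariance form)**: for `μ ≠ 0`, `d∕du ∫ f dμ̂_u |_{u₀} = Cov_{μ̂_{u₀}}(f, ψ′_{u₀})`,
`μ̂_u = μ.tilted (ψ u)` — the derivative of a tilted mean along ANY C¹ one-parameter exponential family is the covariance of the
observable with the PATH DIRECTION `ψ′_u = ∂_u ψ_u` (the straight chord is `WilsonFeynmanHellmann.hasDerivAt_integral_tilted_eq_covariance`;
the countertermed chord of LENS control CARD 11 is module II `…N19TiltPathEndpoints` §2). [folklore] -/
theorem hasDerivAt_integral_tilted_tiltPath_eq_cov [NeZero μ] (hψm : ∀ u, Measurable (ψ u)) (hψ'm : ∀ u, Measurable (ψ' u))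
    (hψd : ∀ u x, HasDerivAt (fun v => ψ v x) (ψ' u x) u)
    (hbd : ∃ ε > 0, ∃ M : ℝ, ∀ u ∈ Metric.ball u₀ ε, ∀ x, |ψ u x| ≤ M ∧ |ψ' u x| ≤ M)
    (hfm : Measurable f) (hfb : ∀ x, |f x| ≤ B) :
    HasDerivAt (fun u => ∫ x, f x ∂(μ.tilted (ψ u))) (cov[f, ψ' u₀; μ.tilted (ψ u₀)]) u₀ := by
  obtain ⟨ε, hε, M, hM⟩ := hbd
  have hu₀ : u₀ ∈ Metric.ball u₀ ε := Metric.mem_ball_self hε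
  haveI : IsProbabilityMeasure (μ.tilted (ψ u₀)) :=
    isProbabilityMeasure_tilted (integrable_of_abs_le (Real.measurable_exp.comp (hψm u₀)) fun x => by
      rw [Real.abs_exp]; exact Real.exp_le_exp.2 ((le_abs_self _).trans (hM u₀ hu₀ x).1))
  have hft : MemLp f 2 (μ.tilted (ψ u₀)) :=
    MemLp.of_bound hfm.aestronglyMeasurable B (Eventually.of_forall fun x => by rw [Real.norm_eq_abs]; exact hfb x)
  have hψt : MemLp (ψ' u₀) 2 (μ.tilted (ψ u₀)) :=
    MemLp.of_bound (hψ'm u₀).aestronglyMeasurable M (Eventually.of_forall fun x => by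
      rw [Real.norm_eq_abs]; exact (hM u₀ hu₀ x).2)
  rw [covariance_eq_sub hft hψt]
  exact hasDerivAt_integral_tilted_tiltPath hψm hψ'm hψd ⟨ε, hε, M, hM⟩ hfm hfb

/-- **THE MASS FACE**: for `μ ≠ 0`, `d∕du log ∫ e^{ψ_u} dμ |_{u₀} = ∫ ψ′_{u₀} dμ̂_{u₀}` — the logarithmic derivative of the MASS of the
un-normalised piece `e^{ψ_u}·μ` is the tilted mean of the path direction. [folklore] -/
theorem hasDerivAt_log_integral_exp_tiltPath [NeZero μ] (hψm : ∀ u, Measurable (ψ u)) (hψ'm : ∀ u, Measurable (ψ' u))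
    (hψd : ∀ u x, HasDerivAt (fun v => ψ v x) (ψ' u x) u)
    (hbd : ∃ ε > 0, ∃ M : ℝ, ∀ u ∈ Metric.ball u₀ ε, ∀ x, |ψ u x| ≤ M ∧ |ψ' u x| ≤ M) :
    HasDerivAt (fun u => Real.log (∫ x, Real.exp (ψ u x) ∂μ)) (∫ x, ψ' u₀ x ∂(μ.tilted (ψ u₀))) u₀ := by
  obtain ⟨ε, hε, M, hM⟩ := hbd
  have hu₀ : u₀ ∈ Metric.ball u₀ ε := Metric.mem_ball_self hε
  have hZ := hasDerivAt_integral_mul_exp_tiltPath (μ := μ) (f := fun _ => (1 : ℝ)) (B := 1) hψm hψ'm hψd ⟨ε, hε, M, hM⟩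
    measurable_const (fun _ => by simp)
  simp only [one_mul] at hZ
  have hexp : Integrable (fun x => Real.exp (ψ u₀ x)) μ :=
    integrable_of_abs_le (Real.measurable_exp.comp (hψm u₀)) fun x => by
      rw [Real.abs_exp]; exact Real.exp_le_exp.2 ((le_abs_self _).trans (hM u₀ hu₀ x).1)
  have hZpos : 0 < ∫ x, Real.exp (ψ u₀ x) ∂μ := integral_exp_pos hexp
  refine (hZ.log hZpos.ne').congr_deriv ?_
  rw [integral_tilted_eq_div]
  congr 1
  exact integral_congr_ae (Eventually.of_forall fun x => by ring)

end Path

/-! ## §2 One class: covariance versus L¹-oscillation [folklore] -/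
section Osc

variable {Ω : Type*} {m₀ : MeasurableSpace Ω} {ν : Measure Ω} [IsProbabilityMeasure ν] {f g : Ω → ℝ} {B : ℝ}

/-- `Cov_ν(f, g) = ∫ f·(g − ∫g dν) dν` for bounded measurable `f` and integrable `g` on a probability space. [folklore] -/
theorem covariance_eq_integral_mul_sub (hfm : Measurable f) (hfb : ∀ x, |f x| ≤ B) (hgi : Integrable g ν) :
    cov[f, g; ν] = ∫ x, f x * (g x - ∫ y, g y ∂ν) ∂ν := by
  have hfb' : ∀ᵐ x ∂ν, ‖f x‖ ≤ B := Eventually.of_forall fun x => by rw [Real.norm_eq_abs]; exact hfb x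
  have hfi : Integrable f ν := N19TiltPathCalculus.integrable_of_abs_le hfm hfb
  have hgc : Integrable (fun x => g x - ∫ y, g y ∂ν) ν := hgi.sub (integrable_const _)
  have hfgc : Integrable (fun x => f x * (g x - ∫ y, g y ∂ν)) ν := hgc.bdd_mul hfm.aestronglyMeasurable hfb'
  have hcgc : Integrable (fun x => (∫ y, f y ∂ν) * (g x - ∫ y, g y ∂ν)) ν := hgc.const_mul _
  unfold covariance
  have hsplit : (fun x => (f x - ∫ y, f y ∂ν) * (g x - ∫ y, g y ∂ν)) =
      fun x => f x * (g x - ∫ y, g y ∂ν) - (∫ y, f y ∂ν) * (g x - ∫ y, g y ∂ν) := by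
    ext x; ring
  rw [hsplit, integral_sub hfgc hcgc, integral_const_mul, integral_sub hgi (integrable_const _), integral_const,
    smul_eq_mul, probReal_univ, one_mul, sub_self, mul_zero, sub_zero]

/-- `|Cov_ν(f, g)| ≤ B·∫|g − ∫g dν| dν` for `|f| ≤ B`: a bounded observable sees `g` only through its L¹-OSCILLATION. [folklore] -/
theorem abs_cov_le_mul_integral_abs_sub (hfm : Measurable f) (hfb : ∀ x, |f x| ≤ B) (hgi : Integrable g ν) :
    |cov[f, g; ν]| ≤ B * ∫ x, |g x - ∫ y, g y ∂ν| ∂ν := by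
  have hgc : Integrable (fun x => g x - ∫ y, g y ∂ν) ν := hgi.sub (integrable_const _)
  rw [covariance_eq_integral_mul_sub hfm hfb hgi]
  calc |∫ x, f x * (g x - ∫ y, g y ∂ν) ∂ν| ≤ ∫ x, |f x * (g x - ∫ y, g y ∂ν)| ∂ν := abs_integral_le_integral_abs
    _ ≤ ∫ x, B * |g x - ∫ y, g y ∂ν| ∂ν := by
        refine integral_mono_of_nonneg (Eventually.of_forall fun x => abs_nonneg _) (hgc.abs.const_mul B)
          (Eventually.of_forall fun x => ?_)
        show |f x * (g x - ∫ y, g y ∂ν)| ≤ B * |g x - ∫ y, g y ∂ν|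
        rw [abs_mul]
        exact mul_le_mul_of_nonneg_right (hfb x) (abs_nonneg _)
    _ = B * ∫ x, |g x - ∫ y, g y ∂ν| ∂ν := integral_const_mul _ _

/-- **THE HALF**: for an INDICATOR observable, `|Cov_ν(1_S, g)| ≤ ½·∫|g − ∫g dν| dν` (`∫_S (g − ḡ) = −∫_{Sᶜ} (g − ḡ)`). [folklore] -/
theorem abs_cov_indicator_le_half_osc {S : Set Ω} (hS : MeasurableSet S) (hgi : Integrable g ν) :
    |cov[S.indicator 1, g; ν]| ≤ (1 / 2) * ∫ x, |g x - ∫ y, g y ∂ν| ∂ν := by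
  set h : Ω → ℝ := fun x => g x - ∫ y, g y ∂ν with hh
  have hhi : Integrable h ν := hgi.sub (integrable_const _)
  have h1m : Measurable (S.indicator (1 : Ω → ℝ)) := measurable_const.indicator hS
  have h1b : ∀ x, |S.indicator (1 : Ω → ℝ) x| ≤ 1 := fun x => by
    by_cases hx : x ∈ S <;> simp [Set.indicator, hx]
  rw [covariance_eq_integral_mul_sub h1m h1b hgi]
  have hind : (fun x => S.indicator (1 : Ω → ℝ) x * (g x - ∫ y, g y ∂ν)) = S.indicator h := by
    ext x; by_cases hx : x ∈ S <;> simp [Set.indicator, hx, hh]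
  rw [hind, integral_indicator hS]
  -- `∫ h = 0`, so `∫_S h = −∫_{Sᶜ} h`
  have hzero : ∫ x, h x ∂ν = 0 := by
    rw [hh, integral_sub hgi (integrable_const _), integral_const, smul_eq_mul, probReal_univ, one_mul, sub_self]
  have hsplit := integral_add_compl hS hhi
  rw [hzero] at hsplit
  have hS' : ∫ x in S, h x ∂ν = -∫ x in Sᶜ, h x ∂ν := by linarith
  have b1 : |∫ x in S, h x ∂ν| ≤ ∫ x in S, |h x| ∂ν := abs_integral_le_integral_abs
  have b2 : |∫ x in Sᶜ, h x ∂ν| ≤ ∫ x in Sᶜ, |h x| ∂ν := abs_integral_le_integral_abs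
  have hsum : ∫ x in S, |h x| ∂ν + ∫ x in Sᶜ, |h x| ∂ν = ∫ x, |h x| ∂ν := integral_add_compl hS hhi.abs
  have : 2 * |∫ x in S, h x ∂ν| ≤ ∫ x, |h x| ∂ν := by
    have e : |∫ x in S, h x ∂ν| = |∫ x in Sᶜ, h x ∂ν| := by rw [hS', abs_neg]
    linarith
  linarith

/-- **THE CONDITIONED HALF** (LENS control g8 GO-17 note (d)): if the set `S` lives in a sub-σ-algebra `m` (a CLASS-LEVEL set) while `g` is finer, then the
oscillation that bounds the covariance is that of the CONDITIONED direction: `|Cov_ν(1_S, g)| ≤ ½·∫|ν[g|m] − ∫g dν| dν` (tower property: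
`∫_S g = ∫_S ν[g|m]`; companion of file P `abs_cov_le_of_condExp`). [folklore] -/
theorem abs_cov_indicator_le_half_condOsc {Ω' : Type*} {m m₀' : MeasurableSpace Ω'} {ν' : Measure Ω'} [IsProbabilityMeasure ν']
    (hm : m ≤ m₀') {S : Set Ω'} (hS : MeasurableSet[m] S) {g' : Ω' → ℝ} (hgi : Integrable g' ν') :
    |cov[S.indicator 1, g'; ν']| ≤ (1 / 2) * ∫ x, |(ν'[g'|m]) x - ∫ y, g' y ∂ν'| ∂ν' := by
  have hS₀ : MeasurableSet[m₀'] S := hm S hS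
  have h1m : Measurable[m₀'] (S.indicator (1 : Ω' → ℝ)) := measurable_const.indicator hS₀
  have h1b : ∀ x, |S.indicator (1 : Ω' → ℝ) x| ≤ 1 := fun x => by
    by_cases hx : x ∈ S <;> simp [Set.indicator, hx]
  have hci : Integrable (ν'[g'|m]) ν' := integrable_condExp
  have hmean : ∫ y, (ν'[g'|m]) y ∂ν' = ∫ y, g' y ∂ν' := integral_condExp hm
  -- the covariance with `g'` equals the covariance with `ν'[g'|m]`
  have hcov : cov[S.indicator 1, g'; ν'] = cov[S.indicator 1, ν'[g'|m]; ν'] := by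
    rw [covariance_eq_integral_mul_sub (ν := ν') h1m h1b hgi, covariance_eq_integral_mul_sub (ν := ν') h1m h1b hci, hmean]
    have e1 : (fun x => S.indicator (1 : Ω' → ℝ) x * (g' x - ∫ y, g' y ∂ν')) = S.indicator fun x => g' x - ∫ y, g' y ∂ν' := by
      ext x; by_cases hx : x ∈ S <;> simp [Set.indicator, hx]
    have e2 : (fun x => S.indicator (1 : Ω' → ℝ) x * ((ν'[g'|m]) x - ∫ y, g' y ∂ν')) =
        S.indicator fun x => (ν'[g'|m]) x - ∫ y, g' y ∂ν' := by
      ext x; by_cases hx : x ∈ S <;> simp [Set.indicator, hx]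
    rw [e1, e2, integral_indicator hS₀, integral_indicator hS₀, integral_sub hgi.integrableOn integrableOn_const,
      integral_sub hci.integrableOn integrableOn_const, setIntegral_condExp hm hgi hS]
  rw [hcov, ← hmean]
  exact abs_cov_indicator_le_half_osc (ν := ν') hS₀ hci

/-- POINTWISE ⇒ ANNEALED: if `|g − c| ≤ r` everywhere then the mean is within `r` of `c` and the L¹-oscillation is `≤ 2r` — the DENS ∕ SHAPE
roads' pointwise log-density sandwich implies the tilt-path data on the straight chord. [folklore] -/
theorem drift_osc_of_pointwise (hgm : Measurable g) {c r : ℝ} (hgc : ∀ x, |g x - c| ≤ r) :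
    |∫ x, g x ∂ν - c| ≤ r ∧ ∫ x, |g x - ∫ y, g y ∂ν| ∂ν ≤ 2 * r := by
  have hgb : ∀ x, |g x| ≤ |c| + r := fun x => by
    calc |g x| = |(g x - c) + c| := by ring_nf
      _ ≤ |g x - c| + |c| := abs_add_le _ _
      _ ≤ |c| + r := by linarith [hgc x]
  have hgi : Integrable g ν := N19TiltPathCalculus.integrable_of_abs_le hgm hgb
  have hmean : |∫ x, g x ∂ν - c| ≤ r := by
    have : ∫ x, g x ∂ν - c = ∫ x, (g x - c) ∂ν := by
      rw [integral_sub hgi (integrable_const c), integral_const, smul_eq_mul, probReal_univ, one_mul]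
    rw [this]
    calc |∫ x, (g x - c) ∂ν| ≤ ∫ x, |g x - c| ∂ν := abs_integral_le_integral_abs
      _ ≤ ∫ x, r ∂ν := integral_mono_of_nonneg (Eventually.of_forall fun x => abs_nonneg _) (integrable_const r)
          (Eventually.of_forall hgc)
      _ = r := by rw [integral_const, smul_eq_mul, probReal_univ, one_mul]
  refine ⟨hmean, ?_⟩
  calc ∫ x, |g x - ∫ y, g y ∂ν| ∂ν ≤ ∫ x, 2 * r ∂ν := by
        refine integral_mono_of_nonneg (Eventually.of_forall fun x => abs_nonneg _) (integrable_const _)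
          (Eventually.of_forall fun x => ?_)
        show |g x - ∫ y, g y ∂ν| ≤ 2 * r
        calc |g x - ∫ y, g y ∂ν| = |(g x - c) - (∫ y, g y ∂ν - c)| := by ring_nf
          _ ≤ |g x - c| + |∫ y, g y ∂ν - c| := abs_sub _ _
          _ ≤ 2 * r := by linarith [hgc x]
    _ = 2 * r := by rw [integral_const, smul_eq_mul, probReal_univ, one_mul]

end Osc

/-! ## §3 Dictionary: tilted laws as normalised un-normalised pieces (16b's TV_cl letters) -/
section Dictionary

variable {Ω : Type*} [MeasurableSpace Ω] {μ : Measure Ω}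

/-- The un-normalised piece `e^{g}·μ` on a set: `(μ.withDensity e^{g}).real S = ∫_S e^{g} dμ` (integrable exponent). [folklore] -/
theorem withDensity_exp_real {g : Ω → ℝ} (hg : Integrable (fun x => Real.exp (g x)) μ) {S : Set Ω} (hS : MeasurableSet S) :
    (μ.withDensity fun x => ENNReal.ofReal (Real.exp (g x))).real S = ∫ x in S, Real.exp (g x) ∂μ := by
  rw [measureReal_def, withDensity_apply _ hS, ← ofReal_integral_eq_lintegral_ofReal hg.integrableOn
    (Eventually.of_forall fun x => (Real.exp_pos _).le), ENNReal.toReal_ofReal (setIntegral_nonneg hS fun x _ => (Real.exp_pos _).le)]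

/-- A tilted law on a set as a RATIO of the un-normalised piece: `(μ.tilted g).real S = (e^{g}μ)(S) ∕ (e^{g}μ)(univ)`. [folklore] -/
theorem tilted_real_eq_div {g : Ω → ℝ} (hg : Integrable (fun x => Real.exp (g x)) μ) {S : Set Ω} (hS : MeasurableSet S) :
    (μ.tilted g).real S = (μ.withDensity fun x => ENNReal.ofReal (Real.exp (g x))).real S /
      (μ.withDensity fun x => ENNReal.ofReal (Real.exp (g x))).real Set.univ := by
  rw [withDensity_exp_real hg hS, withDensity_exp_real hg MeasurableSet.univ, setIntegral_univ, measureReal_def,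
    tilted_apply_eq_ofReal_integral' g hS, integral_div, ENNReal.toReal_ofReal]
  exact div_nonneg (setIntegral_nonneg hS fun x _ => (Real.exp_pos _).le) (integral_nonneg fun x => (Real.exp_pos _).le)

/-- The start of the path: `(μ.tilted 0).real S = μ(S) ∕ μ(univ)` (Mathlib `tilted_zero'`). [folklore] -/
theorem tilted_zero_real_eq_div (S : Set Ω) : (μ.tilted 0).real S = μ.real S / μ.real Set.univ := by
  rw [tilted_zero', measureReal_def, Measure.smul_apply, smul_eq_mul, ENNReal.toReal_mul, ENNReal.toReal_inv,
    measureReal_def, measureReal_def, div_eq_inv_mul]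

end Dictionary

end Summit.QuantumFields.YangMills.BalabanUVNodes.N19TiltPathCalculus

end
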